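import Mathlib.Analysis.InnerProductSpace.Calculus
import Mathlib.Analysis.Calculus.FDeriv.WithLp
import Mathlib.Analysis.Calculus.FDeriv.Pow
import Mathlib.Analysis.Distribution.SchwartzSpace.Deriv
import Literature.Analysis.FluidPDE.TaoAveragedEuler
import Literature.Analysis.FluidPDE.VectorCalculus
import Literature.Analysis.FluidPDE.WholeSpaceIBPIntegrable
import HarnessLib

/-!
# Crux `OddMorawetz.MorawetzKillsTypeI` (stmt-NavierStokesRegularity-1377), line `birth`:
  STUB `stub_weightOne_nullLagrangian`, the isotropic weight-one densities are null Lagrangians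

For the three-parameter family of weight-one cubic jet densities on `ℝ³`
`N(z) = α |z₀|² tr z₁ + β Σᵢⱼ z₀ᵢ z₀ⱼ (z₁ eᵢ)ⱼ + κ Σᵢ z₀ᵢ² (z₁ eᵢ)ᵢ`
(`z₀ ∈ ℝ³` the value slot, `z₁ : ℝ³ [×1]→L ℝ³` the first-derivative slot, `(z₁ eᵢ)ⱼ` its `(i, j)`
entry), the Euler-derivative pairing against a divergence-free direction vanishes:
`∫ DN(Jv(x))[Jb(x)] dx = 0` for a divergence-free Schwartz field `v` and a smooth divergence-free
`b` with `b, Db ∈ L²` (`Jv = (v, Dv, D²v, D³v)` the 3-jet).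

Proof.
1. `N` is a polynomial in finitely many continuous linear coordinates of the jet, so its Fréchet
   derivative is computed by the Leibniz rules (`WeightOneNullLagrangian.fderiv_density_apply`):
   `DN(z)[w] = α (2 ⟨z₀, w₀⟩ tr z₁ + |z₀|² tr w₁) + β Σᵢⱼ ((w₀ᵢ z₀ⱼ + z₀ᵢ w₀ⱼ)(z₁ eᵢ)ⱼ + z₀ᵢ z₀ⱼ (w₁ eᵢ)ⱼ)`
   `+ κ Σᵢ (2 z₀ᵢ w₀ᵢ (z₁ eᵢ)ᵢ + z₀ᵢ² (w₁ eᵢ)ᵢ)`.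
2. At `z = Jv(x)`, `w = Jb(x)` the entries are `(z₁ eᵢ)ⱼ = ∂ᵢ vⱼ`, `(w₁ eᵢ)ⱼ = ∂ᵢ bⱼ`
   (`iteratedFDeriv_one_apply`), `tr z₁ = div v = 0`, `tr w₁ = div b = 0`, so the integrand is the
   reduced density `R = β Σᵢⱼ (vⱼ bᵢ ∂ᵢvⱼ + vᵢ bⱼ ∂ᵢvⱼ + vᵢ vⱼ ∂ᵢbⱼ) + κ Σᵢ (2 vᵢ bᵢ ∂ᵢvᵢ + vᵢ² ∂ᵢbᵢ)`
   (`integrand_eq_reduced`), which is also the divergence of the flux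
   `W = β (½|v|² b + ⟨v, b⟩ v) + κ (vᵢ² bᵢ)ᵢ` (`divergence_flux_eq_reduced`), again because
   `div v = div b = 0`.
3. `W ∈ C¹ ∩ L¹` (`flux_regular`) and `div W = R ∈ L¹` (`integrable_reduced`: every monomial of
   `R` is (bounded Schwartz factor) × (`L²` Schwartz factor) × (`L²` factor `b` or `∂b`)), so
   `∫ R = ∫ div W = 0` by the tree's whole-space divergence theorem
   `integral_divergence_eq_zero_of_integrable` (`WholeSpaceIBPIntegrable.lean`).

The density, the flux and the reduced density are written out in the statements (no
definitions, no notation). Elementary multivariable calculus; no named facts, no new axioms.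
Lands `--supports stmt-NavierStokesRegularity-1377`.
-/

noncomputable section

-- the problem namespace `Summit.NavierStokesRegularity.NavierStokesRegularity` repeats the summit name by design (D-0017)
set_option linter.dupNamespace false

namespace Summit.NavierStokesRegularity.NavierStokesRegularity.Theorems

open MeasureTheory
open scoped RealInnerProductSpace SchwartzMap
open Literature.Analysis Literature.Analysis.FluidPDE

namespace WeightOneNullLagrangian

/-! ### Step 1: the Fréchet derivative of the density -/

/-- **The derivative of the weight-one density** `N(z) = α |z₀|² tr z₁ + β Σᵢⱼ z₀ᵢ z₀ⱼ (z₁ eᵢ)ⱼ +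
κ Σᵢ z₀ᵢ² (z₁ eᵢ)ᵢ` in the direction `w` (the slots `z₂, z₃`, here of arbitrary types `F₂, F₃`,
do not enter):
`DN(z)[w] = α (2 ⟨z₀, w₀⟩ tr z₁ + |z₀|² tr w₁) + β Σᵢⱼ ((w₀ᵢ z₀ⱼ + z₀ᵢ w₀ⱼ)(z₁ eᵢ)ⱼ + z₀ᵢ z₀ⱼ (w₁ eᵢ)ⱼ)`
`+ κ Σᵢ (2 z₀ᵢ w₀ᵢ (z₁ eᵢ)ᵢ + z₀ᵢ² (w₁ eᵢ)ᵢ)` (Leibniz rules for a polynomial in the continuous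
linear jet coordinates `z ↦ z₀ᵢ` and `z ↦ (z₁ e_p)_q`). -/
theorem fderiv_density_apply {F₂ F₃ : Type*} [NormedAddCommGroup F₂] [NormedSpace ℝ F₂]
    [NormedAddCommGroup F₃] [NormedSpace ℝ F₃] (α β κ : ℝ)
    (z w : EuclideanSpace ℝ (Fin 3) ×
      (EuclideanSpace ℝ (Fin 3) [×1]→L[ℝ] EuclideanSpace ℝ (Fin 3)) × F₂ × F₃) :
    fderiv ℝ (fun z : EuclideanSpace ℝ (Fin 3) ×
          (EuclideanSpace ℝ (Fin 3) [×1]→L[ℝ] EuclideanSpace ℝ (Fin 3)) × F₂ × F₃ =>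
        α * (∑ i, z.1 i ^ 2) * (∑ p, z.2.1 (fun _ => EuclideanSpace.single p (1 : ℝ)) p) +
        β * (∑ i, ∑ j, z.1 i * z.1 j * z.2.1 (fun _ => EuclideanSpace.single i (1 : ℝ)) j) +
        κ * (∑ i, z.1 i ^ 2 * z.2.1 (fun _ => EuclideanSpace.single i (1 : ℝ)) i)) z w =
      α * (2 * (∑ i, z.1 i * w.1 i) * (∑ p, z.2.1 (fun _ => EuclideanSpace.single p (1 : ℝ)) p) +
            (∑ i, z.1 i ^ 2) * (∑ p, w.2.1 (fun _ => EuclideanSpace.single p (1 : ℝ)) p)) +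
        β * (∑ i, ∑ j, ((w.1 i * z.1 j + z.1 i * w.1 j) *
              z.2.1 (fun _ => EuclideanSpace.single i (1 : ℝ)) j +
            z.1 i * z.1 j * w.2.1 (fun _ => EuclideanSpace.single i (1 : ℝ)) j)) +
        κ * (∑ i, (2 * z.1 i * w.1 i * z.2.1 (fun _ => EuclideanSpace.single i (1 : ℝ)) i +
            z.1 i ^ 2 * w.2.1 (fun _ => EuclideanSpace.single i (1 : ℝ)) i)) := by
  -- the jet coordinates as continuous linear forms
  obtain ⟨L0, hL0⟩ : ∃ L0 : Fin 3 → (EuclideanSpace ℝ (Fin 3) ×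
      (EuclideanSpace ℝ (Fin 3) [×1]→L[ℝ] EuclideanSpace ℝ (Fin 3)) × F₂ × F₃ →L[ℝ] ℝ),
      ∀ i z, L0 i z = z.1 i :=
    ⟨fun i => (EuclideanSpace.proj i).comp (ContinuousLinearMap.fst ℝ _ _), fun _ _ => rfl⟩
  obtain ⟨L1, hL1⟩ : ∃ L1 : Fin 3 → Fin 3 → (EuclideanSpace ℝ (Fin 3) ×
      (EuclideanSpace ℝ (Fin 3) [×1]→L[ℝ] EuclideanSpace ℝ (Fin 3)) × F₂ × F₃ →L[ℝ] ℝ),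
      ∀ p q z, L1 p q z = z.2.1 (fun _ => EuclideanSpace.single p (1 : ℝ)) q :=
    ⟨fun p q => (EuclideanSpace.proj q).comp
      ((ContinuousMultilinearMap.apply ℝ (fun _ : Fin 1 => EuclideanSpace ℝ (Fin 3))
        (EuclideanSpace ℝ (Fin 3)) (fun _ => EuclideanSpace.single p (1 : ℝ))).comp
        ((ContinuousLinearMap.fst ℝ _ _).comp (ContinuousLinearMap.snd ℝ _ _))), fun _ _ _ => rfl⟩
  -- Leibniz rules for the polynomial in these coordinates
  have h := ((((HasFDerivAt.fun_sum (u := Finset.univ) fun i _ =>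
      ((L0 i).hasFDerivAt (x := z)).pow 2).const_mul α).fun_mul
      (HasFDerivAt.fun_sum (u := Finset.univ) fun p _ => (L1 p p).hasFDerivAt (x := z))).fun_add
      ((HasFDerivAt.fun_sum (u := Finset.univ) fun i _ =>
        HasFDerivAt.fun_sum (u := Finset.univ) fun j _ =>
        (((L0 i).hasFDerivAt (x := z)).fun_mul ((L0 j).hasFDerivAt (x := z))).fun_mul
          ((L1 i j).hasFDerivAt (x := z))).const_mul β)).fun_add
      ((HasFDerivAt.fun_sum (u := Finset.univ) fun i _ =>
        (((L0 i).hasFDerivAt (x := z)).pow 2).fun_mul ((L1 i i).hasFDerivAt (x := z))).const_mul κ)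
  refine (congrArg (fun L : EuclideanSpace ℝ (Fin 3) ×
      (EuclideanSpace ℝ (Fin 3) [×1]→L[ℝ] EuclideanSpace ℝ (Fin 3)) × F₂ × F₃ →L[ℝ] ℝ => L w)
    (h.congr_of_eventuallyEq (Filter.Eventually.of_forall fun z => ?_)).fderiv).trans ?_
  · simp only [hL0, hL1]
  simp only [hL0, hL1, Nat.add_one_sub_one, pow_one, nsmul_eq_mul, Nat.cast_ofNat,
    smul_add, add_apply, smul_apply, sum_apply, smul_eq_mul]
  simp only [Fin.sum_univ_three]
  ring

/-! ### Step 2: coordinates, divergence and the flux -/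

/-- `div v (x) = ∂₀v₀ + ∂₁v₁ + ∂₂v₂` on `ℝ³` (trace in the standard orthonormal basis). -/
theorem divergence_eq_three (v : EuclideanSpace ℝ (Fin 3) → EuclideanSpace ℝ (Fin 3))
    (x : EuclideanSpace ℝ (Fin 3)) :
    VectorCalculus.divergence v x =
      fderiv ℝ v x (EuclideanSpace.single 0 (1 : ℝ)) 0 +
        fderiv ℝ v x (EuclideanSpace.single 1 (1 : ℝ)) 1 +
        fderiv ℝ v x (EuclideanSpace.single 2 (1 : ℝ)) 2 := by
  rw [divergence_eq_sum_inner_fderiv (EuclideanSpace.basisFun (Fin 3) ℝ)]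
  simp only [EuclideanSpace.basisFun_inner, Fin.sum_univ_three]
  simp only [EuclideanSpace.basisFun_apply]

/-- Derivative of a coordinate `y ↦ (f y)ᵢ` of a differentiable field. -/
theorem hasFDerivAt_coord {f : EuclideanSpace ℝ (Fin 3) → EuclideanSpace ℝ (Fin 3)}
    {f' : EuclideanSpace ℝ (Fin 3) →L[ℝ] EuclideanSpace ℝ (Fin 3)} {x : EuclideanSpace ℝ (Fin 3)}
    (hf : HasFDerivAt f f' x) (i : Fin 3) :
    HasFDerivAt (fun y => f y i) ((EuclideanSpace.proj (𝕜 := ℝ) i).comp f') x := by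
  have h := (PiLp.hasFDerivAt_apply (𝕜 := ℝ) 2 (f x) i).comp x hf
  exact h

/-- **The integrand is the reduced density** on divergence-free fields: at `z = Jv(x)`,
`w = Jb(x)` the trace terms of `DN(z)[w]` vanish (`div v (x) = div b (x) = 0`, with
`(D¹v(x) eᵢ)ⱼ = ∂ᵢvⱼ`, `iteratedFDeriv_one_apply`) and the rest is
`R(x) = β Σᵢⱼ (vⱼ bᵢ ∂ᵢvⱼ + vᵢ bⱼ ∂ᵢvⱼ + vᵢ vⱼ ∂ᵢbⱼ) + κ Σᵢ (2 vᵢ bᵢ ∂ᵢvᵢ + vᵢ² ∂ᵢbᵢ)`. -/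
theorem integrand_eq_reduced {F₂ F₃ : Type*} [NormedAddCommGroup F₂] [NormedSpace ℝ F₂]
    [NormedAddCommGroup F₃] [NormedSpace ℝ F₃] (α β κ : ℝ)
    {v b : EuclideanSpace ℝ (Fin 3) → EuclideanSpace ℝ (Fin 3)} {x : EuclideanSpace ℝ (Fin 3)}
    (v₂ w₂ : F₂) (v₃ w₃ : F₃)
    (hv : VectorCalculus.divergence v x = 0) (hb : VectorCalculus.divergence b x = 0) :
    fderiv ℝ (fun z : EuclideanSpace ℝ (Fin 3) ×
          (EuclideanSpace ℝ (Fin 3) [×1]→L[ℝ] EuclideanSpace ℝ (Fin 3)) × F₂ × F₃ =>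
        α * (∑ i, z.1 i ^ 2) * (∑ p, z.2.1 (fun _ => EuclideanSpace.single p (1 : ℝ)) p) +
        β * (∑ i, ∑ j, z.1 i * z.1 j * z.2.1 (fun _ => EuclideanSpace.single i (1 : ℝ)) j) +
        κ * (∑ i, z.1 i ^ 2 * z.2.1 (fun _ => EuclideanSpace.single i (1 : ℝ)) i))
        (v x, iteratedFDeriv ℝ 1 v x, v₂, v₃) (b x, iteratedFDeriv ℝ 1 b x, w₂, w₃) =
      β * (∑ i, ∑ j, (v x j * b x i * fderiv ℝ v x (EuclideanSpace.single i (1 : ℝ)) j +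
          v x i * b x j * fderiv ℝ v x (EuclideanSpace.single i (1 : ℝ)) j +
          v x i * v x j * fderiv ℝ b x (EuclideanSpace.single i (1 : ℝ)) j)) +
        κ * ∑ i, (2 * (v x i * b x i * fderiv ℝ v x (EuclideanSpace.single i (1 : ℝ)) i) +
          v x i * v x i * fderiv ℝ b x (EuclideanSpace.single i (1 : ℝ)) i) := by
  rw [fderiv_density_apply]
  rw [divergence_eq_three] at hv hb
  simp only [iteratedFDeriv_one_apply, Fin.sum_univ_three]
  linear_combination (α * 2 * (v x 0 * b x 0 + v x 1 * b x 1 + v x 2 * b x 2)) * hv +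
    (α * (v x 0 ^ 2 + v x 1 ^ 2 + v x 2 ^ 2)) * hb

/-- **The divergence of the flux is the reduced density** on divergence-free fields: for the
flux `W = β (½|v|² b + ⟨v, b⟩ v) + κ (vᵢ² bᵢ)ᵢ`, at a point where `v, b` are differentiable,
`div W = β (½|v|² div b + ⟨v, Dv b⟩ + ⟨v, b⟩ div v + ⟨v, Db v⟩ + ⟨Dv v, b⟩)`
`+ κ Σᵢ (vᵢ² ∂ᵢbᵢ + 2 vᵢ ∂ᵢvᵢ bᵢ)` (Leibniz rules, trace in the standard basis), which for
`div v (x) = div b (x) = 0` is `R(x)`. -/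
theorem divergence_flux_eq_reduced (β κ : ℝ)
    {v b : EuclideanSpace ℝ (Fin 3) → EuclideanSpace ℝ (Fin 3)} {x : EuclideanSpace ℝ (Fin 3)}
    (hvd : DifferentiableAt ℝ v x) (hbd : DifferentiableAt ℝ b x)
    (hv : VectorCalculus.divergence v x = 0) (hb : VectorCalculus.divergence b x = 0) :
    VectorCalculus.divergence (fun y => β • ((2⁻¹ * ⟪v y, v y⟫) • b y + ⟪v y, b y⟫ • v y) +
        κ • ∑ i, (v y i ^ 2 * b y i) • EuclideanSpace.single i (1 : ℝ)) x =
      β * (∑ i, ∑ j, (v x j * b x i * fderiv ℝ v x (EuclideanSpace.single i (1 : ℝ)) j +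
          v x i * b x j * fderiv ℝ v x (EuclideanSpace.single i (1 : ℝ)) j +
          v x i * v x j * fderiv ℝ b x (EuclideanSpace.single i (1 : ℝ)) j)) +
        κ * ∑ i, (2 * (v x i * b x i * fderiv ℝ v x (EuclideanSpace.single i (1 : ℝ)) i) +
          v x i * v x i * fderiv ℝ b x (EuclideanSpace.single i (1 : ℝ)) i) := by
  have hv' := hvd.hasFDerivAt
  have hb' := hbd.hasFDerivAt
  have hvi := hasFDerivAt_coord hv'
  have hbi := hasFDerivAt_coord hb'
  -- the derivative of the flux
  have hW := (((((hv'.inner ℝ hv').const_mul 2⁻¹).fun_smul hb').fun_add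
      ((hv'.inner ℝ hb').fun_smul hv')).fun_const_smul β).fun_add
      ((HasFDerivAt.fun_sum (u := Finset.univ) fun i _ =>
        (((hvi i).pow 2).fun_mul (hbi i)).smul_const
          (EuclideanSpace.single i (1 : ℝ))).fun_const_smul κ)
  rw [divergence_eq_sum_inner_fderiv (EuclideanSpace.basisFun (Fin 3) ℝ), hW.fderiv]
  rw [divergence_eq_three] at hv hb
  simp only [EuclideanSpace.basisFun_inner]
  simp only [inner_self_eq_norm_sq_to_K, RCLike.ofReal_real_eq_id, id_eq, PiLp.inner_apply,
    RCLike.inner_apply, conj_trivial, Fin.sum_univ_three, Fin.isValue, smul_add,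
    Nat.add_one_sub_one, pow_one, nsmul_eq_mul, Nat.cast_ofNat, EuclideanSpace.basisFun_apply,
    add_apply, smul_apply,
    ContinuousLinearMap.smulRight_apply, ContinuousLinearMap.comp_apply,
    ContinuousLinearMap.prod_apply, fderivInnerCLM_apply, smul_eq_mul, PiLp.proj_apply,
    PiLp.add_apply, PiLp.smul_apply, PiLp.single_apply, mul_ite, mul_one, mul_zero, ↓reduceIte,
    zero_ne_one, add_zero, Fin.reduceEq, one_ne_zero, zero_add]
  linear_combination (β * 2⁻¹ * ‖v x‖ ^ 2) * hb +
    (β * (b x 0 * v x 0 + b x 1 * v x 1 + b x 2 * v x 2)) * hv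

/-! ### Step 3: integrability and regularity -/

/-- A triple product `φ ψ g` resp. `φ g ψ` of real functions with `φ, g ∈ L²` and `ψ` continuous
and bounded is integrable (Hölder). -/
theorem integrable_mul_mul_of_memLp {φ ψ g : EuclideanSpace ℝ (Fin 3) → ℝ} (hφ : MemLp φ 2 volume)
    (hg : MemLp g 2 volume) (hψ : Continuous ψ) {C : ℝ} (hC : ∀ x, ‖ψ x‖ ≤ C) :
    Integrable (fun x => φ x * ψ x * g x) ∧ Integrable (fun x => φ x * g x * ψ x) := by
  have h : Integrable (fun x => ψ x * (φ x * g x)) :=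
    (hφ.integrable_mul hg).bdd_mul hψ.aestronglyMeasurable (ae_of_all _ hC)
  exact ⟨h.congr (ae_of_all _ fun x => by ring), h.congr (ae_of_all _ fun x => by ring)⟩

/-- Coordinates of a continuous `L²` field are `L²`. -/
theorem memLp_coord {g : EuclideanSpace ℝ (Fin 3) → EuclideanSpace ℝ (Fin 3)}
    (hg : MemLp g 2 volume) (hc : Continuous g) (i : Fin 3) :
    MemLp (fun x => g x i) 2 volume :=
  hg.of_le (by fun_prop) (ae_of_all _ fun x => PiLp.norm_apply_le (g x) i)

/-- **The reduced density is integrable** for a Schwartz field `v = f` and a smooth `b` with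
`b, ∂b ∈ L²`: each monomial is (Schwartz coordinate, `L²`) × (Schwartz coordinate or
derivative, bounded) × (`L²` coordinate of `b` or `∂b`). -/
theorem integrable_reduced (β κ : ℝ) (f : 𝓢(EuclideanSpace ℝ (Fin 3), EuclideanSpace ℝ (Fin 3)))
    {b : EuclideanSpace ℝ (Fin 3) → EuclideanSpace ℝ (Fin 3)}
    (hb : ContDiff ℝ (⊤ : ℕ∞) b) (hb2 : MemLp b 2 volume)
    (hDb2 : ∀ w : EuclideanSpace ℝ (Fin 3), MemLp (fun x => fderiv ℝ b x w) 2 volume) :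
    Integrable (fun x =>
      β * (∑ i, ∑ j, (f x j * b x i * fderiv ℝ (⇑f) x (EuclideanSpace.single i (1 : ℝ)) j +
          f x i * b x j * fderiv ℝ (⇑f) x (EuclideanSpace.single i (1 : ℝ)) j +
          f x i * f x j * fderiv ℝ b x (EuclideanSpace.single i (1 : ℝ)) j)) +
        κ * ∑ i, (2 * (f x i * b x i * fderiv ℝ (⇑f) x (EuclideanSpace.single i (1 : ℝ)) i) +
          f x i * f x i * fderiv ℝ b x (EuclideanSpace.single i (1 : ℝ)) i)) := by
  have hbc : Continuous b := hb.continuous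
  have hDbc : ∀ w : EuclideanSpace ℝ (Fin 3), Continuous fun x => fderiv ℝ b x w := fun w =>
    (hb.continuous_fderiv (by simp)).clm_apply continuous_const
  have hDfc : ∀ w : EuclideanSpace ℝ (Fin 3), Continuous fun x => fderiv ℝ (⇑f) x w := fun w =>
    ((f.smooth ⊤).continuous_fderiv (by simp)).clm_apply continuous_const
  -- the `L²` factors
  have hf2 : ∀ i, MemLp (fun x => f x i) 2 volume := memLp_coord (f.memLp 2 volume) f.continuous
  have hb2i : ∀ i, MemLp (fun x => b x i) 2 volume := memLp_coord hb2 hbc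
  have hDb2i : ∀ w q, MemLp (fun x => fderiv ℝ b x w q) 2 volume := fun w =>
    memLp_coord (hDb2 w) (hDbc w)
  -- the bounded factors
  have hfC : ∀ j x, ‖f x j‖ ≤ SchwartzMap.seminorm ℝ 0 0 f := fun j x =>
    (PiLp.norm_apply_le (f x) j).trans (SchwartzMap.norm_le_seminorm ℝ f x)
  have hDfC : ∀ (w : EuclideanSpace ℝ (Fin 3)) q x, ‖fderiv ℝ (⇑f) x w q‖ ≤
      SchwartzMap.seminorm ℝ 0 0
        (SchwartzMap.fderivCLM ℝ (EuclideanSpace ℝ (Fin 3)) (EuclideanSpace ℝ (Fin 3)) f) * ‖w‖ :=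
    fun w q x => by
    refine (PiLp.norm_apply_le _ q).trans (((fderiv ℝ (⇑f) x).le_opNorm _).trans ?_)
    gcongr
    exact SchwartzMap.norm_le_seminorm ℝ (SchwartzMap.fderivCLM ℝ _ _ f) x
  -- the two monomial types
  have M1 : ∀ i j w q, Integrable (fun x => f x i * f x j * fderiv ℝ b x w q) :=
    fun i j w q => (integrable_mul_mul_of_memLp (hf2 i) (hDb2i w q) (by fun_prop) (hfC j)).1
  have M2 : ∀ i j w q, Integrable (fun x => f x i * b x j * fderiv ℝ (⇑f) x w q) :=
    fun i j w q => (integrable_mul_mul_of_memLp (hf2 i) (hb2i j)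
      (show Continuous fun x => fderiv ℝ (⇑f) x w q by have := hDfc w; fun_prop) (hDfC w q)).2
  exact ((integrable_finsetSum _ fun i _ => integrable_finsetSum _ fun j _ =>
      ((M2 j i _ j).add (M2 i j _ j)).add (M1 i j _ j)).const_mul β).add
    ((integrable_finsetSum _ fun i _ => ((M2 i i _ i).const_mul 2).add (M1 i i _ i)).const_mul κ)

/-- **The flux is `C¹` and integrable**: `W = β (½|v|² b + ⟨v, b⟩ v) + κ (vᵢ² bᵢ)ᵢ` with `v = f`
Schwartz and `b` of class `C¹` with `b ∈ L²`; `|W| ≲ (sup |v|) |v| |b|` and `v, b ∈ L²`. -/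
theorem flux_regular (β κ : ℝ) (f : 𝓢(EuclideanSpace ℝ (Fin 3), EuclideanSpace ℝ (Fin 3)))
    {b : EuclideanSpace ℝ (Fin 3) → EuclideanSpace ℝ (Fin 3)} (hb : ContDiff ℝ 1 b)
    (hb2 : MemLp b 2 volume) :
    ContDiff ℝ 1 (fun y => β • ((2⁻¹ * ⟪f y, f y⟫) • b y + ⟪f y, b y⟫ • f y) +
        κ • ∑ i, (f y i ^ 2 * b y i) • EuclideanSpace.single i (1 : ℝ)) ∧
      Integrable (fun y => β • ((2⁻¹ * ⟪f y, f y⟫) • b y + ⟪f y, b y⟫ • f y) +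
        κ • ∑ i, (f y i ^ 2 * b y i) • EuclideanSpace.single i (1 : ℝ)) := by
  have hf1 : ContDiff ℝ 1 (⇑f) := (f.smooth ⊤).of_le (by exact_mod_cast le_top)
  constructor
  · have h1 : ContDiff ℝ 1 fun x => ⟪f x, f x⟫ := hf1.inner ℝ hf1
    have h2 : ContDiff ℝ 1 fun x => ⟪f x, b x⟫ := hf1.inner ℝ hb
    have h3 : ∀ i, ContDiff ℝ 1 fun x => f x i := fun i => contDiff_euclidean.1 hf1 i
    have h4 : ∀ i, ContDiff ℝ 1 fun x => b x i := fun i => contDiff_euclidean.1 hb i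
    exact ((((contDiff_const.mul h1).smul hb).add (h2.smul hf1)).const_smul β).add
      ((ContDiff.sum fun i _ => (((h3 i).pow 2).mul (h4 i)).smul contDiff_const).const_smul κ)
  set C := SchwartzMap.seminorm ℝ 0 0 f
  have hC : ∀ x, ‖f x‖ ≤ C := fun x => SchwartzMap.norm_le_seminorm ℝ f x
  have hC0 : 0 ≤ C := (norm_nonneg _).trans (hC 0)
  have I1 : Integrable (fun x => ‖f x‖ * ‖b x‖) := (f.memLp 2 volume).norm.integrable_mul hb2.norm
  have hfc : Continuous (⇑f) := f.continuous
  have hbc : Continuous b := hb.continuous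
  have key : ∀ {G : Type} [NormedAddCommGroup G] (φ : EuclideanSpace ℝ (Fin 3) → G), Continuous φ →
      (∀ x, ‖φ x‖ ≤ C * (‖f x‖ * ‖b x‖)) → Integrable φ := fun φ hφ hle =>
    (I1.const_mul C).mono' hφ.aestronglyMeasurable (ae_of_all _ hle)
  refine (Integrable.fun_smul β (Integrable.fun_add (key _ (by fun_prop) fun x => ?_)
    (key _ (by fun_prop) fun x => ?_))).fun_add
    (Integrable.fun_smul κ (integrable_finsetSum _ fun i _ => key _ (by fun_prop) fun x => ?_))
  · rw [norm_smul, norm_mul, real_inner_self_eq_norm_sq, norm_pow, norm_norm, norm_inv,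
      Real.norm_ofNat]
    have h1 : ‖f x‖ ^ 2 ≤ C * ‖f x‖ := by
      rw [sq]; exact mul_le_mul_of_nonneg_right (hC x) (norm_nonneg _)
    nlinarith [norm_nonneg (b x), norm_nonneg (f x)]
  · rw [norm_smul]
    calc ‖⟪f x, b x⟫‖ * ‖f x‖ ≤ (‖f x‖ * ‖b x‖) * C :=
          mul_le_mul (norm_inner_le_norm _ _) (hC x) (norm_nonneg _) (by positivity)
      _ = C * (‖f x‖ * ‖b x‖) := by ring
  · rw [norm_smul, PiLp.norm_single, norm_one, mul_one, norm_mul, norm_pow]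
    calc ‖f x i‖ ^ 2 * ‖b x i‖ ≤ ‖f x‖ ^ 2 * ‖b x‖ := by
          gcongr
          · exact PiLp.norm_apply_le (f x) i
          · exact PiLp.norm_apply_le (b x) i
      _ ≤ (C * ‖f x‖) * ‖b x‖ := by
          gcongr
          rw [sq]; exact mul_le_mul_of_nonneg_right (hC x) (norm_nonneg _)
      _ = C * (‖f x‖ * ‖b x‖) := by ring

end WeightOneNullLagrangian

open WeightOneNullLagrangian in
/-- **Stub `stub_weightOne_nullLagrangian`** (crux `OddMorawetz.MorawetzKillsTypeI`,
stmt-NavierStokesRegularity-1377, line `birth`). THE ISOTROPIC WEIGHT-ONE DENSITIES ARE NULL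
LAGRANGIANS ON DIVERGENCE-FREE FIELDS: for the density
`N(z) = α |z₀|² tr z₁ + β Σᵢⱼ z₀ᵢ z₀ⱼ (z₁ eᵢ)ⱼ + κ Σᵢ z₀ᵢ² (z₁ eᵢ)ᵢ` on 3-jets, a divergence-free
Schwartz field `v` and a smooth divergence-free `b` with `b, Db ∈ L²`, the Euler-derivative
pairing vanishes: `∫ DN(Jv)[Jb] = 0`. Proof: write `v = ⇑f` with `f` a Schwartz map; the
integrand is the reduced density `R` (`integrand_eq_reduced`, using `div v = div b = 0`), which
is the divergence of the flux `W = β(½|v|² b + ⟨v,b⟩ v) + κ (vᵢ² bᵢ)ᵢ`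
(`divergence_flux_eq_reduced`); `W ∈ C¹ ∩ L¹` (`flux_regular`), `R ∈ L¹` (`integrable_reduced`),
so `∫ R = ∫ div W = 0` (`integral_divergence_eq_zero_of_integrable`). -/
theorem stub_weightOne_nullLagrangian :
    ∀ (α β κ : ℝ) (v b : EuclideanSpace ℝ (Fin 3) → EuclideanSpace ℝ (Fin 3)),
      Literature.Analysis.FluidPDE.IsSchwartzField v → Literature.Analysis.FluidPDE.VectorCalculus.IsDivFree v →
      ContDiff ℝ (⊤ : ℕ∞) b → Literature.Analysis.FluidPDE.VectorCalculus.IsDivFree b →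
      MeasureTheory.MemLp b 2 MeasureTheory.volume →
      (∀ w : EuclideanSpace ℝ (Fin 3), MeasureTheory.MemLp (fun x => fderiv ℝ b x w) 2 MeasureTheory.volume) →
      ∫ x, fderiv ℝ (fun z : EuclideanSpace ℝ (Fin 3) × (EuclideanSpace ℝ (Fin 3) [×1]→L[ℝ] EuclideanSpace ℝ (Fin 3)) × (EuclideanSpace ℝ (Fin 3) [×2]→L[ℝ] EuclideanSpace ℝ (Fin 3)) × (EuclideanSpace ℝ (Fin 3) [×3]→L[ℝ] EuclideanSpace ℝ (Fin 3)) =>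
            α * (∑ i, z.1 i ^ 2) * (∑ p, z.2.1 (fun _ => EuclideanSpace.single p (1 : ℝ)) p) +
            β * (∑ i, ∑ j, z.1 i * z.1 j * z.2.1 (fun _ => EuclideanSpace.single i (1 : ℝ)) j) +
            κ * (∑ i, z.1 i ^ 2 * z.2.1 (fun _ => EuclideanSpace.single i (1 : ℝ)) i))
          (v x, iteratedFDeriv ℝ 1 v x, iteratedFDeriv ℝ 2 v x, iteratedFDeriv ℝ 3 v x)
          (b x, iteratedFDeriv ℝ 1 b x, iteratedFDeriv ℝ 2 b x, iteratedFDeriv ℝ 3 b x) = 0 := by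
  intro α β κ v b hv hvdiv hb hbdiv hb2 hDb2
  obtain ⟨f, rfl⟩ := hv
  have hfd : Differentiable ℝ (⇑f) := f.differentiable
  have hbd : Differentiable ℝ b := hb.differentiable (by simp)
  -- the integrand is the reduced density `R`, pointwise
  have hpt := fun x => integrand_eq_reduced α β κ (iteratedFDeriv ℝ 2 (⇑f) x)
    (iteratedFDeriv ℝ 2 b x) (iteratedFDeriv ℝ 3 (⇑f) x) (iteratedFDeriv ℝ 3 b x)
    (hvdiv x) (hbdiv x)
  -- `div W = R`, pointwise
  have hW := fun x => divergence_flux_eq_reduced β κ (hfd x) (hbd x) (hvdiv x) (hbdiv x)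
  -- `R ∈ L¹`, `W ∈ C¹ ∩ L¹`
  have hR := integrable_reduced β κ f hb hb2 hDb2
  obtain ⟨hW1, hWi⟩ := flux_regular β κ f (hb.of_le (by exact_mod_cast le_top)) hb2
  rw [integral_congr_ae (ae_of_all _ hpt)]
  have h0 := integral_divergence_eq_zero_of_integrable hW1 hWi
    ((integrable_congr (ae_of_all _ hW)).2 hR)
  rw [integral_congr_ae (ae_of_all _ hW)] at h0
  exact h0

end Summit.NavierStokesRegularity.NavierStokesRegularity.Theorems
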